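import Mathlib
import HarnessLib
import Literature.Probability.MarkovChains.MeanHittingTimeMinimal
import Literature.Probability.MarkovChains.BottleneckRatio

/-!
HONEST FRAMING: exact (Metropolis-corrected) sampling algorithms for lattice gauge theory; figures
of merit are autocorrelation/cost numbers at stated couplings and volumes; no continuum-physics
claim.

# EquilibriumHittingFloor — FROM EQUILIBRIUM, A SET IS HIT NO FASTER THAN ITS BOUNDARY FLOW ALLOWS:
# `E_π(H^A ∧ N) ≥ N·π(Aᶜ) − ½N(N−1)·Q(A,Aᶜ)` FOR EVERY HORIZON `N`, HENCE `E_π(H^A ∧ N) ≥ ½N·π(Aᶜ)` WHILE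
# `(N−1)·Q(A,Aᶜ) ≤ π(Aᶜ)` (lean-2 GEN-17, ours)

Venture-side (OURS).  Cell `lqcd-flow` (pub-lqcd), unit `pub-lqcd-lean-2-g17`, 2026-08-25.  A generic finite-chain
lemma in the vocabulary of `Literature/Probability/MarkovChains` (`meanHitWithin P A n i = E_i(H^A ∧ n)`, Norris'
truncated mean hitting time, `MeanHittingTimeMinimal`; `edgeMeasure π P A B = Q(A,B)`, `BottleneckRatio`): for a
row-stochastic `P` with a STATIONARY probability vector `π ≥ 0` (no reversibility needed) and any set of states `A`,
the equilibrium-averaged truncated hitting time obeys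

  `Σ_i π(i)·E_i(H^A ∧ N) ≥ N·π(Aᶜ) − ½N(N−1)·Q(A,Aᶜ)`.

Mechanism (one induction): `E_π(H^A ∧ (n+1)) = π(Aᶜ) + E_π(H^A ∧ n) − Σ_{i∈A, j∉A} π(i)P(i,j)E_j(H^A ∧ n)` by the
first-step recursion and stationarity, and the correction is `≤ n·Q(A,Aᶜ)` because `E_j(H^A ∧ n) ≤ n`.  It is the
expected-value form of `P_π(H^A ≤ n) ≤ π(A) + n·Q(Aᶜ,A)`: the chain enters `A` only across the cut, whose stationary
flow per step is `Q(A,Aᶜ) = Q(Aᶜ,A)`.  Chapter Y/Z (`Scaling/SimulatedTemperingModeTorpid`,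
`Scaling/ReplicaExchangeModeTorpid`) computed the cut flow of "sector `A` at any level" for the tempering samplers
EXACTLY (`((1−t)/(K+1))·Σ_k Q_k(A,Aᶜ)`); the docking is `Scaling/SimulatedTemperingSectorHitting`.

## What is proved

* `stationaryMean_meanHitWithin_succ` — the recursion identity above (stationarity, no reversibility);
  `boundaryTerm_le` — the correction term is at most `n·Q(A,Aᶜ)`;
  **`stationaryMean_meanHitWithin_ge`** — `Σ_i π(i)E_i(H^A ∧ N) ≥ N·π(Aᶜ) − ½N(N−1)·Q(A,Aᶜ)` for every `N`;
  **`stationaryMean_meanHitWithin_ge_half`** — if `(N−1)·Q(A,Aᶜ) ≤ π(Aᶜ)` then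
  `Σ_i π(i)E_i(H^A ∧ N) ≥ ½N·π(Aᶜ)`;
  **`meanHittingTime_stationary_ge`** — the same floor for the (untruncated, `ℝ≥0∞`-valued) mean hitting times:
  `Σ_i π(i)·k_i^A ≥ N·π(Aᶜ) − ½N(N−1)·Q(A,Aᶜ)` for every `N`.

NOT CLAIMED: the sharper variational form `E_π(H^A) ≥ π(Aᶜ)²/Q(A,Aᶜ)` for reversible chains (Aldous–Fill's
extremal characterisation — not typed); tail bounds `P_π(H^A ≤ n)` (the tree has no path space; the truncated mean
is the available currency); anything measured.  Literature grade (cell rule): ELEMENTARY / folklore (first-step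
analysis + stationarity), NEW TYPING; nothing cited as a fact; no new bib keys.
-/

noncomputable section

open Finset
open Literature.Probability.MarkovChains

namespace Summit.Ventures.LatticeQCDFlow.Scaling

variable {X : Type*} [Fintype X] [DecidableEq X] {P : Matrix X X ℝ} {π : X → ℝ}

/-- **The first-step recursion averaged against a stationary law:**
`Σ_i π(i)E_i(H^A ∧ (n+1)) = π(Aᶜ) + Σ_i π(i)E_i(H^A ∧ n) − Σ_{i ∈ A} Σ_j π(i)P(i,j)E_j(H^A ∧ n)`. [ours] -/
theorem stationaryMean_meanHitWithin_succ (hst : IsStationary π P) (A : Finset X) (n : ℕ) :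
    ∑ i, π i * meanHitWithin P (↑A : Set X) (n + 1) i
      = (∑ i ∈ Aᶜ, π i) + ∑ i, π i * meanHitWithin P (↑A : Set X) n i
        - ∑ i ∈ A, ∑ j, π i * P i j * meanHitWithin P (↑A : Set X) n j := by
  -- split `Σ_i` into `A` and `Aᶜ`
  have hsplit : ∑ i, π i * meanHitWithin P (↑A : Set X) (n + 1) i
      = ∑ i ∈ Aᶜ, π i * (1 + ∑ j, P i j * meanHitWithin P (↑A : Set X) n j) := by
    rw [← Finset.sum_add_sum_compl A]
    have hA : ∑ i ∈ A, π i * meanHitWithin P (↑A : Set X) (n + 1) i = 0 :=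
      Finset.sum_eq_zero fun i hi => by rw [meanHitWithin_of_mem (Finset.mem_coe.mpr hi), mul_zero]
    rw [hA, zero_add]
    refine sum_congr rfl fun i hi => ?_
    rw [meanHitWithin_succ_of_not_mem (fun h => (Finset.mem_compl.mp hi) (Finset.mem_coe.mp h))]
  rw [hsplit]
  -- stationarity: `Σ_i π(i)P(i,j) = π(j)`, so `Σ_{i∉A} π(i)P(i,j) = π(j) − Σ_{i∈A} π(i)P(i,j)`
  have hstat : ∀ j, ∑ i ∈ Aᶜ, π i * P i j = π j - ∑ i ∈ A, π i * P i j := by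
    intro j
    have h := hst j
    rw [← Finset.sum_add_sum_compl A] at h
    linarith
  have hexp : ∑ i ∈ Aᶜ, π i * (1 + ∑ j, P i j * meanHitWithin P (↑A : Set X) n j)
      = (∑ i ∈ Aᶜ, π i) + ∑ j, (∑ i ∈ Aᶜ, π i * P i j) * meanHitWithin P (↑A : Set X) n j := by
    simp_rw [mul_add, mul_one, Finset.sum_add_distrib, Finset.mul_sum]
    congr 1
    rw [Finset.sum_comm]
    refine sum_congr rfl fun j _ => ?_
    rw [Finset.sum_mul]
    exact sum_congr rfl fun i _ => by ring
  rw [hexp]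
  simp_rw [hstat, sub_mul, Finset.sum_sub_distrib]
  have hlast : ∑ j, (∑ i ∈ A, π i * P i j) * meanHitWithin P (↑A : Set X) n j
      = ∑ i ∈ A, ∑ j, π i * P i j * meanHitWithin P (↑A : Set X) n j := by
    rw [Finset.sum_comm]
    refine sum_congr rfl fun i _ => ?_
    rw [Finset.sum_mul]
  rw [hlast]
  ring

/-- **The correction term is at most `n·Q(A,Aᶜ)`** (`E_j(H^A ∧ n) = 0` on `A`, `≤ n` off `A`). [ours] -/
theorem boundaryTerm_le (hP : IsRowStochastic P) (hπ0 : ∀ x, 0 ≤ π x) (A : Finset X) (n : ℕ) :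
    ∑ i ∈ A, ∑ j, π i * P i j * meanHitWithin P (↑A : Set X) n j ≤ n * edgeMeasure π P A Aᶜ := by
  unfold edgeMeasure
  rw [Finset.mul_sum]
  refine sum_le_sum fun i _ => ?_
  rw [← Finset.sum_add_sum_compl A, Finset.mul_sum]
  have hA : ∑ j ∈ A, π i * P i j * meanHitWithin P (↑A : Set X) n j = 0 :=
    Finset.sum_eq_zero fun j hj => by rw [meanHitWithin_of_mem (Finset.mem_coe.mpr hj), mul_zero]
  rw [hA, zero_add]
  refine sum_le_sum fun j _ => ?_
  calc π i * P i j * meanHitWithin P (↑A : Set X) n j ≤ π i * P i j * n :=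
        mul_le_mul_of_nonneg_left (meanHitWithin_le hP n j) (mul_nonneg (hπ0 i) (hP.1 i j))
    _ = n * (π i * P i j) := by ring

/-- **FROM EQUILIBRIUM, `E_π(H^A ∧ N) ≥ N·π(Aᶜ) − ½N(N−1)·Q(A,Aᶜ)`** for every horizon `N`: a set whose boundary
carries little stationary flow is hit late. [ours] -/
theorem stationaryMean_meanHitWithin_ge (hP : IsRowStochastic P) (hst : IsStationary π P) (hπ0 : ∀ x, 0 ≤ π x)
    (A : Finset X) (N : ℕ) :
    N * (∑ i ∈ Aᶜ, π i) - (N * (N - 1) / 2) * edgeMeasure π P A Aᶜ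
      ≤ ∑ i, π i * meanHitWithin P (↑A : Set X) N i := by
  induction N with
  | zero => simp [meanHitWithin_zero]
  | succ n ih =>
    rw [stationaryMean_meanHitWithin_succ hst A n]
    have hb := boundaryTerm_le hP hπ0 A n
    push_cast
    nlinarith [hb, ih]

/-- **While `(N−1)·Q(A,Aᶜ) ≤ π(Aᶜ)`, `E_π(H^A ∧ N) ≥ ½N·π(Aᶜ)`.** [ours] -/
theorem stationaryMean_meanHitWithin_ge_half (hP : IsRowStochastic P) (hst : IsStationary π P)
    (hπ0 : ∀ x, 0 ≤ π x) (A : Finset X) (N : ℕ) (hN : ((N : ℝ) - 1) * edgeMeasure π P A Aᶜ ≤ ∑ i ∈ Aᶜ, π i) :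
    (N : ℝ) * (∑ i ∈ Aᶜ, π i) / 2 ≤ ∑ i, π i * meanHitWithin P (↑A : Set X) N i := by
  have h := stationaryMean_meanHitWithin_ge hP hst hπ0 A N
  have hN0 : (0 : ℝ) ≤ N := Nat.cast_nonneg N
  nlinarith [mul_le_mul_of_nonneg_left hN hN0]

/-- **The same floor for the untruncated mean hitting times** `k_i^A = E_i(H^A) ∈ [0,∞]`:
`Σ_i π(i)·k_i^A ≥ N·π(Aᶜ) − ½N(N−1)·Q(A,Aᶜ)` for every `N`. [ours] -/
theorem meanHittingTime_stationary_ge (hP : IsRowStochastic P) (hst : IsStationary π P) (hπ0 : ∀ x, 0 ≤ π x)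
    (A : Finset X) (N : ℕ) :
    ENNReal.ofReal (N * (∑ i ∈ Aᶜ, π i) - (N * (N - 1) / 2) * edgeMeasure π P A Aᶜ)
      ≤ ∑ i, ENNReal.ofReal (π i) * meanHittingTime P (↑A : Set X) i := by
  have h := stationaryMean_meanHitWithin_ge hP hst hπ0 A N
  calc ENNReal.ofReal (N * (∑ i ∈ Aᶜ, π i) - (N * (N - 1) / 2) * edgeMeasure π P A Aᶜ)
      ≤ ENNReal.ofReal (∑ i, π i * meanHitWithin P (↑A : Set X) N i) := ENNReal.ofReal_le_ofReal h
    _ = ∑ i, ENNReal.ofReal (π i * meanHitWithin P (↑A : Set X) N i) :=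
        ENNReal.ofReal_sum_of_nonneg fun i _ => mul_nonneg (hπ0 i) (meanHitWithin_nonneg hP.1 N i)
    _ = ∑ i, ENNReal.ofReal (π i) * ENNReal.ofReal (meanHitWithin P (↑A : Set X) N i) :=
        sum_congr rfl fun i _ => ENNReal.ofReal_mul (hπ0 i)
    _ ≤ ∑ i, ENNReal.ofReal (π i) * meanHittingTime P (↑A : Set X) i :=
        sum_le_sum fun i _ => mul_le_mul_of_nonneg_left (ofReal_meanHitWithin_le_meanHittingTime N i) bot_le

end Summit.Ventures.LatticeQCDFlow.Scaling

end
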